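import Mathlib
import Summits.Ventures.PercRepro2.PMK5Deg5LocusBern

/-!
# THE PATTERN TREE: A `K₃` CLASS SUM AT ONE PROFILE OF `K₆`, KERNEL-COMPUTABLE
(blind cell PercRepro2, mine-2 g32; the positive side of the equality locus needs the class sum
`cntPos15 k − cntNeg15 k` at FIFTY witness profiles — fifty digits of Theorem 30's certificate — and this file
reads them without the slice numbers)

A triple count `Deg3.cnt3n T₁ T₂ T₃ k` is a sum over the `2^45` configuration triples filtered by the profile `k`;
the triples of profile `k` are exactly the choices, edge by edge, of a three-bit PATTERN `(a, b, c)` with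
`a + b + c = k_e` (`pats`: one pattern for the digits `0` and `3`, three for `1` and `2`).  The pattern tree
`patGo` walks the edges `14, …, 0` branching over the patterns of each digit and evaluates the three tables at
the leaves — `∏_e C(3, k_e) ≤ 3^15` leaves in general, `≤ 3^5 = 243` at a witness of support `≤ 5`.
**`cnt3n_eq_cntPat`**: the tree is the count (the invariant `patGo_eq`, by induction on the edges as in
`Deg5Kron6.go_eq`), so **`cntPos15_eq_pat` / `cntNeg15_eq_pat`** write the fifteen-edge counts of `K₃` as
kernel-computable pattern sums.  Standard axioms.
-/

namespace Summit.Ventures.PercRepro2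

open Hub

namespace Deg5

namespace Locus

/-! ## The patterns of a digit and the tree -/

/-- The three-bit patterns `(a, b, c)` of an edge with the open count `j`: `a + b + c = j`. -/
def pats : Fin 4 → List (Bool × Bool × Bool)
  | 0 => [(false, false, false)]
  | 1 => [(true, false, false), (false, true, false), (false, false, true)]
  | 2 => [(true, true, false), (true, false, true), (false, true, true)]
  | 3 => [(true, true, true)]

/-- The open count of a pattern. -/
def patSum (q : Bool × Bool × Bool) : ℕ := q.1.toNat + q.2.1.toNat + q.2.2.toNat

/-- `pats j` lists exactly the patterns of open count `j`: a list sum over `pats j` is the filtered sum over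
the eight patterns. -/
lemma sum_pats (j : Fin 4) (f : Bool × Bool × Bool → ℕ) :
    ((pats j).map f).sum = ∑ q ∈ Finset.univ.filter (fun q : Bool × Bool × Bool => patSum q = j), f q := by
  fin_cases j <;> simp [pats, patSum, Finset.sum_filter, Fintype.sum_prod_type, add_assoc]

/-- **The pattern tree**: on the edges `< n` branch over the patterns of the digit `k e`; at a leaf evaluate the
three tables on the three configurations built so far. -/
def patGo (T₁ T₂ T₃ : (Fin 15 → Bool) → Bool) (k : Fin 15 → Fin 4) :
    ℕ → (Fin 15 → Bool) → (Fin 15 → Bool) → (Fin 15 → Bool) → ℕ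
  | 0, x, y, w => (T₁ x).toNat * (T₂ y).toNat * (T₃ w).toNat
  | n + 1, x, y, w =>
      ((pats (k (Fin.ofNat 15 n))).map fun q =>
        patGo T₁ T₂ T₃ k n (Function.update x (Fin.ofNat 15 n) q.1)
          (Function.update y (Fin.ofNat 15 n) q.2.1) (Function.update w (Fin.ofNat 15 n) q.2.2)).sum

/-- The triple count of the profile `k` by the pattern tree over all fifteen edges. -/
def cntPat (T₁ T₂ T₃ : (Fin 15 → Bool) → Bool) (k : Fin 15 → Fin 4) : ℕ :=
  patGo T₁ T₂ T₃ k 15 (fun _ => false) (fun _ => false) (fun _ => false)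

/-! ## The invariant of the tree -/

/-- Two configurations agreeing on the edges `≥ n`. -/
def AgreeGe (n : ℕ) (ω s : Fin 15 → Bool) : Prop := ∀ e : Fin 15, n ≤ (e : ℕ) → s e = ω e

/-- Agreement on the edges `≥ n` is decidable (a finite conjunction). -/
instance (n : ℕ) (ω s : Fin 15 → Bool) : Decidable (AgreeGe n ω s) := by
  unfold AgreeGe; infer_instance

/-- The profile condition on the edges `< n`. -/
def ProfLt (n : ℕ) (k : Fin 15 → Fin 4) (x y w : Fin 15 → Bool) : Prop :=
  ∀ e : Fin 15, (e : ℕ) < n → openCount x y w e = (k e : ℕ)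

/-- The profile condition is decidable. -/
instance (n : ℕ) (k : Fin 15 → Fin 4) (x y w : Fin 15 → Bool) : Decidable (ProfLt n k x y w) := by
  unfold ProfLt; infer_instance

/-- The triples agreeing with `(x, y, w)` on the edges `≥ n` and of profile `k` on the edges `< n`. -/
def S (n : ℕ) (k : Fin 15 → Fin 4) (x y w : Fin 15 → Bool) :
    Finset ((Fin 15 → Bool) × (Fin 15 → Bool) × (Fin 15 → Bool)) :=
  Finset.univ.filter fun t => AgreeGe n x t.1 ∧ AgreeGe n y t.2.1 ∧ AgreeGe n w t.2.2 ∧ ProfLt n k t.1 t.2.1 t.2.2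

/-- The edge `n < 15` as an element of `Fin 15`. -/
lemma ofNat_val {n : ℕ} (hn : n < 15) : ((Fin.ofNat 15 n : Fin 15) : ℕ) = n := by
  simp [Fin.ofNat, Nat.mod_eq_of_lt hn]

/-- Agreement on the edges `≥ n + 1` together with the state `a` at the edge `n` is agreement on the edges
`≥ n` with the edge `n` updated to `a`. -/
lemma agree_succ_iff {n : ℕ} (hn : n < 15) (ω s : Fin 15 → Bool) (a : Bool) :
    (AgreeGe (n + 1) ω s ∧ s (Fin.ofNat 15 n) = a) ↔ AgreeGe n (Function.update ω (Fin.ofNat 15 n) a) s := by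
  unfold AgreeGe
  constructor
  · rintro ⟨h, hs⟩ e he
    by_cases hen : e = Fin.ofNat 15 n
    · rw [hen, Function.update_self, hs]
    · rw [Function.update_of_ne hen]
      refine h e ?_
      have : (e : ℕ) ≠ n := fun h' => hen (Fin.ext (by rw [ofNat_val hn, h']))
      omega
  · intro h
    refine ⟨fun e he => ?_, ?_⟩
    · have hen : e ≠ Fin.ofNat 15 n := fun h' => by
        rw [h', ofNat_val hn] at he; omega
      rw [← Function.update_of_ne hen a ω]
      exact h e (by omega)
    · have := h (Fin.ofNat 15 n) (by rw [ofNat_val hn])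
      rwa [Function.update_self] at this

/-- The fibre of `S (n + 1)` over a pattern `q` at the edge `n`: `S n` with the edge `n` updated to `q` if
`q` has the open count `k n`, empty otherwise. -/
lemma S_succ_fibre {n : ℕ} (hn : n < 15) (k : Fin 15 → Fin 4) (x y w : Fin 15 → Bool)
    (q : Bool × Bool × Bool) :
    (S (n + 1) k x y w).filter
        (fun t => (t.1 (Fin.ofNat 15 n), t.2.1 (Fin.ofNat 15 n), t.2.2 (Fin.ofNat 15 n)) = q) =
      if patSum q = (k (Fin.ofNat 15 n) : ℕ) then
        S n k (Function.update x (Fin.ofNat 15 n) q.1) (Function.update y (Fin.ofNat 15 n) q.2.1)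
          (Function.update w (Fin.ofNat 15 n) q.2.2)
      else ∅ := by
  obtain ⟨a, b, c⟩ := q
  ext t
  simp only [S, Finset.mem_filter, Finset.mem_univ, true_and, Prod.mk.injEq]
  split_ifs with hq
  · simp only [Finset.mem_filter, Finset.mem_univ, true_and]
    rw [← agree_succ_iff hn x t.1 a, ← agree_succ_iff hn y t.2.1 b, ← agree_succ_iff hn w t.2.2 c]
    constructor
    · rintro ⟨⟨h1, h2, h3, h4⟩, ha, hb, hc⟩
      refine ⟨⟨h1, ha⟩, ⟨h2, hb⟩, ⟨h3, hc⟩, fun e he => h4 e (by omega)⟩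
    · rintro ⟨⟨h1, ha⟩, ⟨h2, hb⟩, ⟨h3, hc⟩, h4⟩
      refine ⟨⟨h1, h2, h3, fun e he => ?_⟩, ha, hb, hc⟩
      rcases Nat.lt_succ_iff_lt_or_eq.1 he with he | he
      · exact h4 e he
      · have hen : e = Fin.ofNat 15 n := Fin.ext (by rw [ofNat_val hn, he])
        rw [hen]
        unfold openCount
        rw [ha, hb, hc]
        unfold patSum at hq
        exact hq
  · simp only [Finset.notMem_empty, iff_false, not_and]
    rintro ⟨-, -, -, h4⟩ ha hb hc
    apply hq
    have := h4 (Fin.ofNat 15 n) (by rw [ofNat_val hn]; omega)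
    unfold openCount at this
    rw [ha, hb, hc] at this
    exact this

/-- **The invariant of the pattern tree**: `patGo n x y w` is the sum of the table products over `S n k x y w`. -/
theorem patGo_eq (T₁ T₂ T₃ : (Fin 15 → Bool) → Bool) (k : Fin 15 → Fin 4) :
    ∀ (n : ℕ), n ≤ 15 → ∀ x y w : Fin 15 → Bool,
      patGo T₁ T₂ T₃ k n x y w = ∑ t ∈ S n k x y w, (T₁ t.1).toNat * (T₂ t.2.1).toNat * (T₃ t.2.2).toNat
  | 0, _, x, y, w => by
    have hS : S 0 k x y w = {(x, y, w)} := by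
      ext t
      simp only [S, Finset.mem_filter, Finset.mem_univ, true_and, Finset.mem_singleton, AgreeGe, ProfLt,
        Nat.zero_le, true_implies, Nat.not_lt_zero, false_implies, implies_true, and_true]
      constructor
      · rintro ⟨h1, h2, h3⟩
        exact Prod.ext (funext h1) (Prod.ext (funext h2) (funext h3))
      · rintro rfl
        exact ⟨fun _ => rfl, fun _ => rfl, fun _ => rfl⟩
    rw [hS, Finset.sum_singleton]
    rfl
  | n + 1, hn, x, y, w => by
    have hn' : n < 15 := by omega
    rw [patGo]
    simp only [patGo_eq T₁ T₂ T₃ k n (by omega)]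
    rw [sum_pats]
    rw [← Finset.sum_fiberwise (S (n + 1) k x y w)
      (fun t => (t.1 (Fin.ofNat 15 n), t.2.1 (Fin.ofNat 15 n), t.2.2 (Fin.ofNat 15 n)))]
    rw [Finset.sum_filter]
    refine Finset.sum_congr rfl fun q _ => ?_
    rw [S_succ_fibre hn' k x y w q]
    split_ifs with hq
    · rfl
    · simp

/-- **The pattern tree is the triple count**: `cnt3n T₁ T₂ T₃ k = cntPat T₁ T₂ T₃ k`. -/
theorem cnt3n_eq_cntPat (T₁ T₂ T₃ : (Fin 15 → Bool) → Bool) (k : Fin 15 → Fin 4) :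
    Deg3.cnt3n T₁ T₂ T₃ k = cntPat T₁ T₂ T₃ k := by
  unfold cntPat Deg3.cnt3n
  rw [patGo_eq T₁ T₂ T₃ k 15 le_rfl]
  apply Finset.sum_congr
  · ext t
    simp only [S, Finset.mem_filter, Finset.mem_univ, true_and, AgreeGe, ProfLt, PMTyped.prof_eq_iff]
    constructor
    · intro h
      exact ⟨fun e he => absurd he (by omega), fun e he => absurd he (by omega),
        fun e he => absurd he (by omega), fun e _ => h e⟩
    · rintro ⟨-, -, -, h4⟩ e
      exact h4 e e.isLt
  · intros; rfl

end Locus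

end Deg5

end Summit.Ventures.PercRepro2
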